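import Summits.FinalStateConjecture.FinalStateConjecture.Theorems.EIHFluxBalanceModulatedKerrHandoffTrimDefs
import Summits.FinalStateConjecture.FinalStateConjecture.Theorems.EIHFluxBalanceModulatedKerrHandoffTrimSchedules
import Summits.FinalStateConjecture.FinalStateConjecture.Theorems.EIHFluxBalanceModulatedKerrHandoffTrimPlumbing
import Literature.Geometry.Lorentzian.TameFamilyOffCompact
import Literature.Geometry.Lorentzian.AdmissibleDataLocality
import Literature.Geometry.Lorentzian.InitialDataLocality
import HarnessLib

/-!
# `EIHFluxBalance.ModulatedKerrHandoff` (item stmt-FinalStateConjecture-17402): the kick ⊕ trim assembly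
# — a local kick family patched with a receding tame trimming is a TAME escape curve

`exists_tameCurve_of_kick_trim`: from a tame trimming family `T` of the datum `d` on its sole
Dafermos–Rodnianski end (`IsTameTrimmingFamily`), a local kick family `G` through `d` (`IsLocalKick`), and
a property `P` holding for every admissible datum with the sections of `G c` off `e.far R` and those of
`T R` on `e.far R` whenever `0 < c₀ < δ` and `R ≥ max R₀ (ρ₁ c₀)` (threshold `ρ₁` locally bounded on
`(0, δ)`), one gets a TAME curve of admissible data through `d` (on a collar of `e`) whose members with
small `c₀ > 0` satisfy `P`. Construction: `F c = (T (ρ c₀)) patched by (G c)` along a smooth receding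
schedule `ρ ≥ ρ₁, R₀, R_K` (`exists_schedule`); joint smoothness is local (`isSmoothDataFamily_of_locally_eq`),
tameness is `IsTameDataFamily.of_wDist_tendsto` over the tame kick family
(`isTameDataFamily_restrict_of_agree_off_compact_one`) with `wDist (F c) (G c) = wDist (T (ρ c₀)) d → 0`,
admissibility is locality of the constraints (`isVacuumAt_congr`, `mem_admissibleVacuumData_of_agree_off_compact`).
This is the common assembly of the two trimming lines of the crux (`Lines/trim_kick_censorship.lean`,
strategist; `Lines/trim_on_the_cure.lean`, crux-plan) — proof carried verbatim from the strategist's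
skeleton (planner-cstrat-stmt-FinalStateConjecture-17402-r1-0, 2026-08-17).
-/

noncomputable section

namespace Summit.FinalStateConjecture.FinalStateConjecture.Theorems.EIHFluxBalance.TameTemplate

open scoped Topology Manifold ContDiff ENNReal
open Bundle Filter Set Function TopologicalSpace Literature.Geometry.Lorentzian InitialDataSet

-- D-0017: single-problem summit, `Summit.<S>.<S>.…` by design.
set_option linter.dupNamespace false

section Core

variable {X : Type} [TopologicalSpace X] [ChartedSpace E3 X] [IsManifold (𝓡 3) ∞ X]
  [T2Space X] [SecondCountableTopology X] [ConnectedSpace X]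

/-- **TAME ESCAPE FROM A KICK LEG AND A TRIM LEG (the assembly's construction).** Let `d` be a datum
with sole Dafermos–Rodnianski end `e` (mass `M₀`), `T` a tame trimming family of `d` on `e` beyond
`R₀`, `G` a local kick family through `d`, and suppose a property `P` holds for every admissible
datum which has the sections of `G c` off `e.far R` and those of `T R` on `e.far R`, whenever
`0 < c₀ < δ` and `R ≥ max R₀ (ρ₁ c₀)` for a threshold `ρ₁` locally bounded on `(0, δ)`. Then through
`d` passes a TAME curve of admissible data (on a collar of `e`) whose members with small `c₀ > 0`
satisfy `P`: the members are `T (ρ c₀)` patched by `G c` on the core, along a smooth receding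
schedule `ρ ≥ ρ₁` (`exists_schedule`); joint smoothness is local (`isSmoothDataFamily_of_locally_eq`:
near core points the family is `G`, near far points it is `c ↦ T (ρ c₀)`), tameness is
`IsTameDataFamily.of_wDist_tendsto` over the tame kick family
(`isTameDataFamily_restrict_of_agree_off_compact_one`) with `wDist (F c) (G c) = wDist (T (ρ c₀)) d → 0`,
admissibility is locality of the constraints. [cite: Christodoulou1999, p. A24] -/
theorem exists_tameCurve_of_kick_trim :
    ∀ {X : Type} [TopologicalSpace X] [ChartedSpace E3 X] [IsManifold (𝓡 3) ∞ X] [T2Space X] [SecondCountableTopology X] [ConnectedSpace X] (d : InitialDataSet (𝓡 3) X) (e : AFEnd X) (M₀ R₀ : ℝ) (T : ℝ → InitialDataSet (𝓡 3) X) (M : ℝ → ℝ) (hsole : e.IsSoleEnd) (hDR : e.IsStronglyAsymptoticallyFlatDR d M₀) (hT : IsTameTrimmingFamily X e d M₀ R₀ T M) (G : EuclideanSpace ℝ (Fin 1) → InitialDataSet (𝓡 3) X) (hG : IsLocalKick X d G) {δ : ℝ} {ρ₁ : ℝ → ℝ} (hδ : 0 < δ) (hbd : ∀ s : ℝ, 0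 < s → s < δ → ∃ C : ℝ, ∀ᶠ s' in 𝓝 s, ρ₁ s' ≤ C) (P : InitialDataSet (𝓡 3) X → Prop) (hgood : ∀ c : EuclideanSpace ℝ (Fin 1), 0 < c 0 → c 0 < δ → ∀ R : ℝ, R₀ ≤ R → ρ₁ (c 0) ≤ R → ∀ D' ∈ admissibleVacuumData X, (∀ x ∉ e.far R, D'.h.inner x = (G c).h.inner x ∧ D'.k x = (G c).k x) → (∀ x ∈ e.far R, D'.h.inner x = (T R).h.inner x ∧ D'.k x = (T R).k x) → P D'), ∃ (e' : AFEnd X) (F : EuclideanSpace ℝ (Fin 1) → InitialDataSet (𝓡 3) X), IsTameDataFamily e' 1 F ∧ F 0 = d ∧ (∀ c, F c ∈ admissibleVacuumData X) ∧ ∃ ε > (0 : ℝ), ∀ c, 0 < c 0 → c 0 < ε → P (F c) := by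
  intro X _ _ _ _ _ _ d e M₀ R₀ T M hsole hDR hT G hG δ ρ₁ hδ hbd P hgood
  classical
  obtain ⟨hGs, hG0, hGadm, K, hK, hagree⟩ := hG
  obtain ⟨hTspec, hTsmooth, hMcont, hMlim, hwlim⟩ := hT
  -- radii: the kick support sits inside `closedFar Rb`'s complement, far regions beyond `Rb` miss `K`
  obtain ⟨R_K, hR_K⟩ := e.exists_forall_far_disjoint hK
  set Rb : ℝ := max R_K e.R + 1 with hRb_def
  have hRbR : e.R < Rb := by
    have := le_max_right R_K e.R
    linarith
  have hRbK : R_K < Rb := by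
    have := le_max_left R_K e.R
    linarith
  have hfarK : ∀ R, Rb ≤ R → ∀ x ∈ e.far R, x ∉ K := fun R hR x hx hxK ↦
    Set.disjoint_left.1 (hR_K R (hRbK.le.trans hR)) hx hxK
  set W : Set X := (e.closedFar Rb)ᶜ with hW_def
  have hKW : K ⊆ W := by
    intro x hxK hxC
    exact Set.disjoint_left.1 (hR_K R_K le_rfl) (e.closedFar_subset_far hRbK hxC) hxK
  have hW_open : IsOpen W := (e.isClosed_closedFar hRbR).isOpen_compl
  have hfarW : ∀ R, Rb ≤ R → ∀ x ∈ W, x ∉ e.far R := fun R hR x hxW hx ↦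
    hxW ((e.far_mono hR).trans (e.far_subset_closedFar Rb) hx)
  -- the smooth receding schedule
  set A : ℝ := max R₀ Rb with hA_def
  obtain ⟨ρ, hρ_smooth, hρA, hρ₁, hρ_lim⟩ := exists_schedule hδ hbd A
  have hρR₀ : ∀ s, 0 < s → R₀ ≤ ρ s := fun s hs ↦ (le_max_left _ _).trans (hρA s hs)
  have hρRb : ∀ s, 0 < s → Rb ≤ ρ s := fun s hs ↦ (le_max_right _ _).trans (hρA s hs)
  -- the patch data and the family
  have hPD : ∀ (c : EuclideanSpace ℝ (Fin 1)) (R : ℝ), R₀ ≤ R → Rb ≤ R →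
      (T R).PatchData W K (G c).h.inner (G c).k := fun c R hR₀ hR ↦
    patchData_kick_trim e hRbR hR hK hKW (hTspec R hR₀).2.2.2 (hagree c)
  set F : EuclideanSpace ℝ (Fin 1) → InitialDataSet (𝓡 3) X := fun c ↦
    if hc : 0 < c 0 then
      (T (ρ (c 0))).patch (hPD c (ρ (c 0)) (hρR₀ _ hc) (hρRb _ hc))
    else G c with hF_def
  have hF_pos : ∀ c (hc : 0 < c 0),
      F c = (T (ρ (c 0))).patch (hPD c (ρ (c 0)) (hρR₀ _ hc) (hρRb _ hc)) := fun c hc ↦ by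
    simp only [hF_def, dif_pos hc]
  have hF_nonpos : ∀ c, ¬ 0 < c 0 → F c = G c := fun c hc ↦ by
    simp only [hF_def, dif_neg hc]
  -- sections of the members with `c₀ > 0`
  have hF_core : ∀ c, 0 < c 0 → ∀ x ∉ e.far (ρ (c 0)),
      (F c).h.inner x = (G c).h.inner x ∧ (F c).k x = (G c).k x := by
    intro c hc x hx
    rw [hF_pos c hc]
    by_cases hxW : x ∈ W
    · exact ⟨patch_h_inner_of_mem _ hxW, patch_k_of_mem _ hxW⟩
    · have hxK : x ∉ K := fun h ↦ hxW (hKW h)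
      rw [patch_h_inner_of_not_mem _ hxW, patch_k_of_not_mem _ hxW,
        ((hTspec _ (hρR₀ _ hc)).2.2.2 x hx).1, ((hTspec _ (hρR₀ _ hc)).2.2.2 x hx).2,
        (hagree c x hxK).1, (hagree c x hxK).2]
      exact ⟨rfl, rfl⟩
  have hF_far : ∀ c, 0 < c 0 → ∀ x ∈ e.far (ρ (c 0)),
      (F c).h.inner x = (T (ρ (c 0))).h.inner x ∧ (F c).k x = (T (ρ (c 0))).k x := by
    intro c hc x hx
    rw [hF_pos c hc]
    have hxW : x ∉ W := fun h ↦ hfarW _ (hρRb _ hc) x h hx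
    exact ⟨patch_h_inner_of_not_mem _ hxW, patch_k_of_not_mem _ hxW⟩
  have hF_offK : ∀ c, 0 < c 0 → ∀ x ∉ K,
      (F c).h.inner x = (T (ρ (c 0))).h.inner x ∧ (F c).k x = (T (ρ (c 0))).k x := by
    intro c hc x hxK
    rw [hF_pos c hc]
    exact ⟨patch_h_inner_of_not_mem_closed _ hxK, patch_k_of_not_mem_closed _ hxK⟩
  -- admissibility of the members
  have hF_adm : ∀ c, F c ∈ admissibleVacuumData X := by
    intro c
    by_cases hc : 0 < c 0
    · have hTadm : T (ρ (c 0)) ∈ admissibleVacuumData X := (hTspec _ (hρR₀ _ hc)).1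
      refine mem_admissibleVacuumData_of_agree_off_compact hTadm ?_ hK (hF_offK c hc)
      intro inst x
      by_cases hxW : x ∈ W
      · -- near `x ∈ W` the member is the kicked datum `G c`
        haveI : (G c).metric.HasLeviCivita := (G c).metric.hasLeviCivita
        have hv : (G c).IsVacuumConstraintSolution := (hGadm c).1.1
        have hev : ∀ᶠ y in 𝓝 x, (F c).h.inner y = (G c).h.inner y ∧ (F c).k y = (G c).k y := by
          rw [hF_pos c hc]
          exact patch_eventuallyEq_of_mem (hPD c (ρ (c 0)) (hρR₀ _ hc) (hρRb _ hc)) hxW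
        refine (isVacuumAt_congr (D := G c) (D' := F c) ?_ ?_).1 (hv x)
        · exact hev.mono fun y hy ↦ hy.1.symm
        · exact hev.mono fun y hy ↦ hy.2.symm
      · -- near `x ∉ K` the member is the trimmed datum
        have hxK : x ∉ K := fun h ↦ hxW (hKW h)
        haveI : (T (ρ (c 0))).metric.HasLeviCivita := (T (ρ (c 0))).metric.hasLeviCivita
        have hv : (T (ρ (c 0))).IsVacuumConstraintSolution := hTadm.1.1
        have hev : ∀ᶠ y in 𝓝 x, (F c).h.inner y = (T (ρ (c 0))).h.inner y ∧
            (F c).k y = (T (ρ (c 0))).k y := by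
          rw [hF_pos c hc]
          exact patch_eventuallyEq_of_not_mem (hPD c (ρ (c 0)) (hρR₀ _ hc) (hρRb _ hc)) hxK
        refine (isVacuumAt_congr (D := T (ρ (c 0))) (D' := F c) ?_ ?_).1 (hv x)
        · exact hev.mono fun y hy ↦ hy.1.symm
        · exact hev.mono fun y hy ↦ hy.2.symm
    · rw [hF_nonpos c hc]
      exact hGadm c
  -- joint smoothness (local: near core points the family is `G`, near far points `c ↦ T (ρ c₀)`)
  have hproj : ContDiff ℝ ∞ (fun c : EuclideanSpace ℝ (Fin 1) ↦ c 0) :=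
    contDiff_piLp_apply (𝕜 := ℝ) (n := ∞) (p := 2) (E := fun _ : Fin 1 => ℝ) (i := 0)
  have hproj_cont : Continuous (fun c : EuclideanSpace ℝ (Fin 1) ↦ c 0) := hproj.continuous
  have hF_smooth : IsSmoothDataFamily 1 F := by
    refine isSmoothDataFamily_of_locally_eq fun p ↦ ?_
    obtain ⟨c, x⟩ := p
    by_cases hc : 0 < c 0
    · by_cases hxK : x ∈ K
      · -- near `(c, x)` with `x ∈ K ⊆ W`: the family is `G`
        refine ⟨G, hGs, ?_⟩
        have h1 : ∀ᶠ c' in 𝓝 c, 0 < c' 0 := hproj_cont.continuousAt.eventually (eventually_gt_nhds hc)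
        have h2 : ∀ᶠ y in 𝓝 x, y ∈ W := hW_open.mem_nhds (hKW hxK)
        filter_upwards [h1.prod_nhds h2] with q hq
        exact hF_core q.1 hq.1 q.2 (hfarW _ (hρRb _ hq.1) q.2 hq.2)
      · -- near `(c, x)` with `x ∉ K`: the family is `c ↦ T (ρ c₀)`, smooth along a global schedule
        obtain ⟨ρ', hρ', hρ'A, hρ'eq⟩ :=
          exists_contDiff_extension_Ici hρ_smooth hρA (half_pos hc)
        refine ⟨fun c' ↦ T (ρ' (c' 0)), hTsmooth (fun c' ↦ ρ' (c' 0)) (hρ'.comp hproj)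
          (fun c' ↦ (le_max_left _ _).trans (hρ'A _)), ?_⟩
        have h1 : ∀ᶠ c' in 𝓝 c, c 0 / 2 < c' 0 :=
          hproj_cont.continuousAt.eventually (eventually_gt_nhds (by linarith))
        have h2 : ∀ᶠ y in 𝓝 x, y ∉ K := hK.isClosed.isOpen_compl.mem_nhds hxK
        filter_upwards [h1.prod_nhds h2] with q hq
        have hq0 : 0 < q.1 0 := by linarith [hq.1]
        rw [hρ'eq _ hq.1.le]
        exact hF_offK q.1 hq0 q.2 hq.2
    · -- near `(c, x)` with `c₀ ≤ 0`: the family is `G` (the trimming radius has receded past `x`)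
      refine ⟨G, hGs, ?_⟩
      obtain ⟨V, hV, Rstar, hRstar⟩ := e.exists_nhds_forall_disjoint_far x
      have h1 : ∀ᶠ c' in 𝓝 c, 0 < c' 0 → Rstar ≤ ρ (c' 0) := by
        rcases lt_or_eq_of_le (not_lt.1 hc) with hlt | heq
        · exact (hproj_cont.continuousAt.eventually (eventually_lt_nhds hlt)).mono
            fun c' hc' hc'' ↦ absurd hc'' (not_lt.2 hc'.le)
        · have hev : ∀ᶠ s in 𝓝[>] (0 : ℝ), Rstar ≤ ρ s := hρ_lim.eventually (eventually_ge_atTop _)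
          rw [eventually_nhdsWithin_iff] at hev
          have hc0 : ContinuousAt (fun c' : EuclideanSpace ℝ (Fin 1) ↦ c' 0) c :=
            hproj_cont.continuousAt
          rw [ContinuousAt, heq] at hc0
          exact (hc0.eventually hev).mono fun c' hc' hpos ↦ hc' hpos
      filter_upwards [h1.prod_nhds (Filter.Eventually.of_forall (p := fun y ↦ y ∈ V → y ∈ V)
        fun _ h ↦ h), prod_mem_nhds univ_mem hV] with q hq hqV
      by_cases hq0 : 0 < q.1 0
      · exact hF_core q.1 hq0 q.2 fun hfar ↦
          Set.disjoint_left.1 (hRstar _ (hq.1 hq0)) hfar hqV.2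
      · rw [hF_nonpos q.1 hq0]
        exact ⟨rfl, rfl⟩
  -- tameness on the collar `e.restrict (e.R + 1)`
  have hR₁ : e.R < e.R + 1 := by linarith
  have hGt : IsTameDataFamily (e.restrict hR₁.le) 1 G := by
    have hagree0 : ∀ c, ∀ x ∉ K, (G c).h.inner x = (G 0).h.inner x ∧ (G c).k x = (G 0).k x := by
      intro c x hx
      rw [hG0]
      exact hagree c x hx
    have hDR0 : e.IsStronglyAsymptoticallyFlatDR (G 0) M₀ := by rw [hG0]; exact hDR
    exact isTameDataFamily_restrict_of_agree_off_compact_one hGs hsole hDR0 hK hagree0 hR₁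
  have hF_tame : IsTameDataFamily (e.restrict hR₁.le) 1 F := by
    -- the mass function of the members
    set m : ℝ → ℝ := fun s ↦ if 0 < s then M (ρ s) else M₀ with hm_def
    have hm_cont : Continuous m := by
      refine continuous_iff_continuousAt.2 fun s ↦ ?_
      rcases lt_trichotomy s 0 with hs | hs | hs
      · have hev : (fun _ : ℝ ↦ M₀) =ᶠ[𝓝 s] m := (eventually_lt_nhds hs).mono fun t ht ↦ by
          simp only [hm_def, if_neg (not_lt.2 ht.le)]
        exact continuousAt_const.congr hev
      · subst hs
        have hm0 : m 0 = M₀ := by simp only [hm_def, lt_irrefl, if_false]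
        rw [continuousAt_iff_continuous_left'_right']
        constructor
        · have hev : (fun _ : ℝ ↦ M₀) =ᶠ[𝓝[<] (0 : ℝ)] m := by
            filter_upwards [self_mem_nhdsWithin] with t ht
            simp only [hm_def, if_neg (not_lt.2 (le_of_lt (Set.mem_Iio.1 ht)))]
          show Tendsto m (𝓝[<] 0) (𝓝 (m 0))
          rw [hm0]
          exact tendsto_const_nhds.congr' hev
        · have hev : (fun t : ℝ ↦ M (ρ t)) =ᶠ[𝓝[>] (0 : ℝ)] m := by
            filter_upwards [self_mem_nhdsWithin] with t ht
            simp only [hm_def, if_pos (show 0 < t from ht)]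
          show Tendsto m (𝓝[>] 0) (𝓝 (m 0))
          rw [hm0]
          exact (hMlim.comp hρ_lim).congr' hev
      · have hev : (fun t : ℝ ↦ M (ρ t)) =ᶠ[𝓝 s] m := (eventually_gt_nhds hs).mono fun t ht ↦ by
          simp only [hm_def, if_pos ht]
        have hρc : ContinuousAt ρ s := hρ_smooth.continuousOn.continuousAt (Ioi_mem_nhds hs)
        have hMc : ContinuousWithinAt M (Ici R₀) (ρ s) := hMcont _ (hρR₀ s hs)
        have h1 : ContinuousWithinAt (fun t : ℝ ↦ M (ρ t)) (Ioi 0) s :=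
          hMc.comp hρc.continuousWithinAt fun t ht ↦ hρR₀ t ht
        exact (h1.continuousAt (Ioi_mem_nhds hs)).congr hev
    -- decay of the members on the collared end, with mass `m c₀`
    have hF_DR : ∀ c, (e.restrict hR₁.le).IsStronglyAsymptoticallyFlatDR (F c) (m (c 0)) := by
      intro c
      rw [e.isStronglyAsymptoticallyFlatDR_restrict_iff hR₁.le]
      by_cases hc : 0 < c 0
      · simp only [hm_def, if_pos hc]
        exact AFEnd.IsStronglyAsymptoticallyFlatDR.congr_of_eqOn_far (R₀ := ρ (c 0))
          (fun q hq ↦ (hF_far c hc q hq).1) (fun q hq ↦ (hF_far c hc q hq).2)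
          (hTspec _ (hρR₀ _ hc)).2.2.1
      · simp only [hm_def, if_neg hc]
        rw [hF_nonpos c hc]
        exact AFEnd.IsStronglyAsymptoticallyFlatDR.congr_of_eqOn_far (R₀ := Rb)
          (fun q hq ↦ (hagree c q (hfarK Rb le_rfl q hq)).1)
          (fun q hq ↦ (hagree c q (hfarK Rb le_rfl q hq)).2) hDR
    -- the far surgery has vanishing weighted size: `wDist (F c) (G c) = wDist (T (ρ c₀)) d → 0`
    set u : ℝ → ℝ≥0∞ := fun s ↦ if 0 < s then e.wDist (T (ρ s)) d else 0 with hu_def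
    have hle : ∀ c, (e.restrict hR₁.le).wDist (F c) (G c) ≤ u (c 0) := by
      intro c
      by_cases hc : 0 < c 0
      · simp only [hu_def, if_pos hc]
        have heq : (e.restrict hR₁.le).wDist (F c) (G c) =
            (e.restrict hR₁.le).wDist (T (ρ (c 0))) d := by
          refine wDist_eq_of_forall _ fun x ↦ ?_
          by_cases hx : x ∈ e.far (ρ (c 0))
          · exact Or.inr ⟨hF_far c hc x hx, hagree c x (hfarK _ (hρRb _ hc) x hx)⟩
          · exact Or.inl ⟨hF_core c hc x hx, (hTspec _ (hρR₀ _ hc)).2.2.2 x hx⟩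
        rw [heq]
        exact wDist_restrict_le e hR₁.le _ _
      · simp only [hu_def, if_neg hc]
        rw [hF_nonpos c hc, AFEnd.wDist_self]
    have hu : Tendsto u (𝓝 0) (𝓝 0) := by
      have hleft : Tendsto u (𝓝[≤] 0) (𝓝 0) := by
        refine tendsto_const_nhds.congr' ?_
        filter_upwards [self_mem_nhdsWithin] with t ht
        simp only [hu_def, if_neg (not_lt.2 (Set.mem_Iic.1 ht))]
      have hright : Tendsto u (𝓝[>] 0) (𝓝 0) := by
        refine (hwlim.comp hρ_lim).congr' ?_
        filter_upwards [self_mem_nhdsWithin] with t ht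
        simp only [hu_def, if_pos (show 0 < t from ht), Function.comp_apply]
      have h := hleft.sup hright
      rwa [nhdsLE_sup_nhdsGT] at h
    have hu' : Tendsto (fun c : EuclideanSpace ℝ (Fin 1) ↦ u (c 0)) (𝓝 0) (𝓝 0) := by
      have h0 : ContinuousAt (fun c : EuclideanSpace ℝ (Fin 1) ↦ c 0) 0 := hproj_cont.continuousAt
      rw [ContinuousAt] at h0
      simp only [PiLp.zero_apply] at h0
      exact hu.comp h0
    have hw : Tendsto (fun c ↦ (e.restrict hR₁.le).wDist (F c) (G c)) (𝓝 0) (𝓝 0) :=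
      tendsto_of_tendsto_of_tendsto_of_le_of_le tendsto_const_nhds hu' (fun c ↦ bot_le) hle
    have h0 : F 0 = G 0 := hF_nonpos 0 (by simp)
    exact hGt.of_wDist_tendsto hF_smooth h0 (hm_cont.comp hproj_cont) hF_DR hw
  -- conclusion
  refine ⟨e.restrict hR₁.le, F, hF_tame, ?_, hF_adm, δ / 2, by positivity, fun c hc hcδ ↦ ?_⟩
  · have h0 : ¬ (0 : ℝ) < (0 : EuclideanSpace ℝ (Fin 1)) 0 := by simp
    rw [hF_nonpos 0 h0, hG0]
  · exact hgood c hc (by linarith) (ρ (c 0)) (hρR₀ _ hc) (hρ₁ _ hc hcδ) (F c) (hF_adm c)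
      (hF_core c hc) (hF_far c hc)

end Core

end Summit.FinalStateConjecture.FinalStateConjecture.Theorems.EIHFluxBalance.TameTemplate

end
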